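import Mathlib

/-!
# `Balaban1983to89.B2Eq2106LogZSum` — [Balaban1982Higgs2] pp. 578–579: **(2.105) ⇒ «the sum of the expressions (2.104)
over j = 0, 1, …, k − 1 is equal to (2.106)»** — PROVED (log-derivatives of a product of positive smooth factors along the
line `τ ↦ τθ_{k+1}A′^{(k)} + B̃`), together with the p. 578 scale/volume bookkeeping
`O((Lʲε)^κ)|B^{k−j}(Λ₂^{(k)})| = O((Lᵏε)^κ)|Λ₂^{(k)}|L^{(j−k)κ₀}, κ₀ = κ − d` (EXACT identity) and the summability over `j` that
makes the gathered error of (2.107) again `O((Lᵏε)^κ)|Λ₂^{(k)}|` uniformly in `k`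

statement-level skeleton of published theorems with citation tags; proofs where landed; nothing here is a claim about the Yang–Mills mass gap

CITATION HEADER.  T. Bałaban, *(Higgs)₂,₃ quantum fields in a finite volume. II. An upper bound*, Commun. Math. Phys. **86**
(1982) 555–594, doi:10.1007/bf01214890 [Balaban1982Higgs2] (cell paper B2; PDF held `paper:balaban1982-cmp86-higgs23-ii`,
journal page = PDF page + 554; pp. 578–579 READ AS IMAGES on the ×2 renders
`run/shared/lean/pub/pub-balaban/b2b-balaban-ref1/pages/1982-cmp86-higgs23-II/1982-cmp86-higgs23-II-p024-x2.png`, `…-p025-x2.png`).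
Cell `lit-balaban` (HOME `run/shared/lean/pub/lit-balaban/`), unit `lit-balaban-r14` gen 5 (reader/typer r14 = B2 second reader);
SKELETON row **B2.Eq2.103** ((2.99)–(2.107); fold owner r02 `lit-balaban-r02/ROWS-B2.md`, members (2.99)–(2.103) kernel-checked
by p04 in `B2Eq299Expansion` / `B1Eq346DetFactorization` / `B2Ineq2103LogDet`; members (2.104)–(2.107) listed «—»): this file
supplies the model-independent part of (2.104) → (2.106) → (2.107).  Referee ref-4.

WHAT IS PRINTED (verbatim).  p. 578 [PDF 24]: *"A simple analysis of the operator W^{(j)} shows that the last term on the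
right side of (2.103) can be estimated by O((Lʲε)^κ)|B^{k−j}(Λ₂^{(k)})| = O((Lᵏε)^κ)|Λ₂^{(k)}|L^{(j−k)κ₀}, with κ > d, κ₀ > 0.
[…] Finally we get the following expression Σ_{n=1}^{n̄} (1/n!)(dⁿ/dτⁿ) log Z^{(j)}_{Λ₅^{(j)}}(Bʲ(Λ₂^{(j)}), τθ_{k+1}A′^{(k),L^{−j}}
+ B̃)|_{τ=0}. (2.104) […] Using Proposition I.2.1, we can replace the propagator G_j(Bʲ(Λ₂^{(j)}), B̃) by G_j(Bᵏ(Λ₀^{(k)}), B̃)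
and the terms containing the difference of these propagators can be estimated by O((Lʲε)^κ)|B^{k−j}(Λ₂^{(k)})| =
O((Lᵏε)^κ)|Λ₂^{(k)}|L^{(j−k)κ₀} with arbitrary κ > d, κ₀ = κ − d. Similarly using Proposition I.2.3 the propagator
C^{(j)}_{Λ₅^{(j)}}(Bʲ(Λ₂^{(j)}), B̃) can be replaced by C^{(j)}(Bᵏ(Λ₀^{(k)}), B̃). Thus we estimate (2.104) by the same expression
but without the subscript Λ₅^{(j)} and with Bʲ(Λ₂^{(j)}) replaced by Bᵏ(Λ₀^{(k)}), plus an error O((Lᵏε)^κ)|Λ₂^{(k)}|L^{(j−k)κ₀}."*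
p. 579 [PDF 25]: *"Finally we rescale the expressions from 1-lattice to η-lattice. Now we can use the formula (I.2.40) for a
composition of Z^{(j)} factors: Π_{j=0}^{k−1} Z^{(j),Lʲη}(Bᵏ(Λ₀^{(k)}), ·) = Z_k(Bᵏ(Λ₀^{(k)}), ·). (2.105) This formula implies
that the sum of the expressions over j = 0, 1, …, k − 1 is equal to Σ_{n=1}^{n̄} (1/n!)(dⁿ/dτⁿ) log Z_k(Bᵏ(Λ₀^{(k)}),
τθ_{k+1}A′^{(k)} + B̃)|_{τ=0}. (2.106)"*

DICTIONARY.  The `Z`-factors are positive real functions of the external vector field; along the printed line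
`τ ↦ τθ_{k+1}A′^{(k)} + B̃` they become one-variable functions `g j : ℝ → ℝ` (↤ `τ ↦ Z^{(j),Lʲη}(Bᵏ(Λ₀^{(k)}), τθ_{k+1}A′ + B̃)`,
after the replacements of p. 578) and `G : ℝ → ℝ` (↤ `τ ↦ Z_k(Bᵏ(Λ₀^{(k)}), τθ_{k+1}A′ + B̃)`); (2.105) is the pointwise
product identity `∏_{j<k} g j τ = G τ` (= [Balaban1982Higgs1] (2.40), kernel `B1Eq239Normalization`, not re-derived here);
`(dⁿ/dτⁿ)(·)|_{τ=0}` ↦ Mathlib's `iteratedDeriv n (·) 0`; the expression (2.104)ⱼ ↦ `Σ_{n ∈ Icc 1 n̄} (1/n!)·iteratedDeriv n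
(log ∘ g j) 0`, (2.106) ↦ the same with `G` (↤ `Z_k`).  In §3: `L` the scale factor, `ε` the lattice spacing, `d` the dimension, `κ > d`,
`κ₀ = κ − d`, `|B^{k−j}(Λ)| = L^{(k−j)d}|Λ|` (a block of `T^{(k)}` seen on `T^{(j)}` has `L^{(k−j)d}` points).

WHAT THIS MODULE PROVES (kernel-checked, 0 `sorry`, standard axioms; THEOREMS ONLY — no `def`, no new `Prop` fact).
§1 `iteratedDeriv_fun_sum` (n-th derivative of a finite sum, [folklore]); `iteratedDeriv_log_prod` — for finitely many
   factors positive near `τ₀` and `Cⁿ` at `τ₀`: `Σ_j (dⁿ/dτⁿ) log g_j (τ₀) = (dⁿ/dτⁿ) log (∏_j g_j) (τ₀)`.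
§2 **`sum_expr2104_eq_2106`** (`′`: global form) — (2.105) ⇒ `Σ_{j<k} (2.104)_j = (2.106)`: for factors `g j` positive near 0
   and `C^{n̄}` at 0, with `∏_{j<k} g j = G` near 0: `Σ_{j<k} Σ_{n=1}^{n̄} (1/n!)(log g_j)^{(n)}(0) = Σ_{n=1}^{n̄} (1/n!)(log G)^{(n)}(0)`.
§3 **`scale_volume_578`** — the EXACT identity `(Lʲε)^κ·L^{(k−j)d} = (Lᵏε)^κ·L^{−(k−j)(κ−d)}` behind «O((Lʲε)^κ)|B^{k−j}(Λ₂^{(k)})|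
   = O((Lᵏε)^κ)|Λ₂^{(k)}|L^{(j−k)κ₀}, κ₀ = κ − d»; **`sum_scale_errors_le`** — summing these errors over `j = 0, …, k − 1` gives
   `≤ C(Lᵏε)^κ|Λ₂^{(k)}|/(L^{κ₀} − 1)`, i.e. again `O((Lᵏε)^κ)|Λ₂^{(k)}|` UNIFORMLY in `k` (geometric sum, `L > 1`, `κ₀ > 0`) — the
   arithmetic of «Gathering together all the expansions and the estimates of the factors Z^{(j)}» before (2.107).
HONEST SCOPE.  The displays (2.104) and (2.107) themselves (the perturbative one-loop content, «a simple analysis of the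
operator W^{(j)}», the uses of Propositions I.2.1/I.2.3) are NOT formalized; (2.105) = (I.2.40) enters as the hypothesis
`h2105`; what is kernel-checked is exactly the calculus identity the sentence «This formula implies …» asserts and the
scale bookkeeping of p. 578.
-/

noncomputable section

open Finset Real
open scoped BigOperators Topology

namespace Literature.MathematicalPhysics.QuantumFieldTheory.Balaban1983to89.B2Eq2106LogZSum

/-! ## §1 Iterated derivatives of finite sums and of the logarithm of a finite product -/

/-- The `n`-th derivative of a finite sum of functions `Cⁿ` at the point is the sum of the `n`-th derivatives (the first half
of «the sum of the expressions over j … is equal to (2.106)»). [folklore] [cite: Balaban1982Higgs2, (2.106) p.579] -/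
theorem iteratedDeriv_fun_sum {ι : Type*} (u : Finset ι) {f : ι → ℝ → ℝ} {n : ℕ} {x : ℝ}
    (h : ∀ i ∈ u, ContDiffAt ℝ n (f i) x) :
    iteratedDeriv n (fun y => ∑ i ∈ u, f i y) x = ∑ i ∈ u, iteratedDeriv n (f i) x := by
  rw [iteratedDeriv_eq_iteratedFDeriv, iteratedFDeriv_fun_sum_apply h, _root_.sum_apply]
  exact Finset.sum_congr rfl fun i _ => by rw [iteratedDeriv_eq_iteratedFDeriv]

/-- **`Σ_j (dⁿ/dτⁿ) log g_j = (dⁿ/dτⁿ) log ∏_j g_j` at `τ₀`** for finitely many factors, each `Cⁿ` at `τ₀` and positive on a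
neighbourhood of `τ₀` (so that `log ∏ = Σ log` near `τ₀`). [folklore] [cite: Balaban1982Higgs2, (2.105)–(2.106) p.579] -/
theorem iteratedDeriv_log_prod {ι : Type*} (u : Finset ι) {g : ι → ℝ → ℝ} {n : ℕ} {τ₀ : ℝ}
    (hg : ∀ j ∈ u, ContDiffAt ℝ n (g j) τ₀) (hpos : ∀ j ∈ u, ∀ᶠ τ in 𝓝 τ₀, 0 < g j τ) :
    ∑ j ∈ u, iteratedDeriv n (fun τ => Real.log (g j τ)) τ₀
      = iteratedDeriv n (fun τ => Real.log (∏ j ∈ u, g j τ)) τ₀ := by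
  have hev : (fun τ => Real.log (∏ j ∈ u, g j τ)) =ᶠ[𝓝 τ₀] fun τ => ∑ j ∈ u, Real.log (g j τ) := by
    have hall : ∀ᶠ τ in 𝓝 τ₀, ∀ j ∈ u, 0 < g j τ := (u.eventually_all).2 hpos
    filter_upwards [hall] with τ hτ
    exact Real.log_prod (s := u) (f := fun j => g j τ) fun j hj => (hτ j hj).ne'
  rw [hev.iteratedDeriv_eq, iteratedDeriv_fun_sum u]
  exact fun j hj => (hg j hj).log ((hpos j hj).self_of_nhds).ne'

/-! ## §2 (2.105) ⇒ Σⱼ (2.104)ⱼ = (2.106) -/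

/-- **(2.105) ⇒ «the sum of the expressions (2.104) over j = 0, 1, …, k − 1 is equal to (2.106)»** (p. 579, verbatim: *"This
formula implies that the sum of the expressions over j = 0, 1, …, k − 1 is equal to Σ_{n=1}^{n̄} (1/n!)(dⁿ/dτⁿ) log
Z_k(Bᵏ(Λ₀^{(k)}), τθ_{k+1}A′^{(k)} + B̃)|_{τ=0}. (2.106)"*).  Hypotheses: the factors `g j` (↤ the `Z^{(j),Lʲη}(Bᵏ(Λ₀^{(k)}), ·)`
along the line `τθ_{k+1}A′ + B̃`) are positive and `C^{n̄}` at `τ = 0`, and (2.105) `∏_{j<k} g j τ = G τ` (↤ `Z_k`) holds near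
`τ = 0`. PROVED: interchange of the two finite sums, `iteratedDeriv_log_prod` at each order `n ≤ n̄`.
[cite: Balaban1982Higgs2, (2.105)–(2.106) p.579] -/
theorem sum_expr2104_eq_2106 (k nbar : ℕ) {g : ℕ → ℝ → ℝ} {G : ℝ → ℝ}
    (hg : ∀ j ∈ range k, ContDiffAt ℝ nbar (g j) 0) (hpos : ∀ j ∈ range k, ∀ᶠ τ in 𝓝 (0 : ℝ), 0 < g j τ)
    (h2105 : ∀ᶠ τ in 𝓝 (0 : ℝ), ∏ j ∈ range k, g j τ = G τ) :
    ∑ j ∈ range k, ∑ n ∈ Icc 1 nbar, (1 / (n.factorial : ℝ)) * iteratedDeriv n (fun τ => Real.log (g j τ)) 0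
      = ∑ n ∈ Icc 1 nbar, (1 / (n.factorial : ℝ)) * iteratedDeriv n (fun τ => Real.log (G τ)) 0 := by
  rw [Finset.sum_comm]
  refine Finset.sum_congr rfl fun n hn => ?_
  have hn' : n ≤ nbar := (Finset.mem_Icc.1 hn).2
  have hgn : ∀ j ∈ range k, ContDiffAt ℝ n (g j) 0 := fun j hj =>
    (hg j hj).of_le (by exact_mod_cast hn')
  rw [← Finset.mul_sum, iteratedDeriv_log_prod (range k) hgn hpos]
  congr 1
  refine Filter.EventuallyEq.iteratedDeriv_eq n ?_
  filter_upwards [h2105] with τ hτ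
  rw [hτ]

/-- The same with the product identity (2.105) and positivity holding for all `τ` (the printed situation: the `Z`-factors
are Gaussian normalization integrals, positive for every external field). [cite: Balaban1982Higgs2, (2.105)–(2.106) p.579] -/
theorem sum_expr2104_eq_2106' (k nbar : ℕ) {g : ℕ → ℝ → ℝ} {G : ℝ → ℝ}
    (hg : ∀ j ∈ range k, ContDiffAt ℝ nbar (g j) 0) (hpos : ∀ j ∈ range k, ∀ τ, 0 < g j τ)
    (h2105 : ∀ τ, ∏ j ∈ range k, g j τ = G τ) :
    ∑ j ∈ range k, ∑ n ∈ Icc 1 nbar, (1 / (n.factorial : ℝ)) * iteratedDeriv n (fun τ => Real.log (g j τ)) 0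
      = ∑ n ∈ Icc 1 nbar, (1 / (n.factorial : ℝ)) * iteratedDeriv n (fun τ => Real.log (G τ)) 0 :=
  sum_expr2104_eq_2106 k nbar hg (fun j hj => Filter.Eventually.of_forall (hpos j hj))
    (Filter.Eventually.of_forall h2105)

/-! ## §3 The scale/volume bookkeeping of p. 578 and the summability over `j` -/

/-- **p. 578, the EXACT identity behind «O((Lʲε)^κ)|B^{k−j}(Λ₂^{(k)})| = O((Lᵏε)^κ)|Λ₂^{(k)}|L^{(j−k)κ₀}, κ₀ = κ − d»**:
a block of `T^{(k)}` has `L^{(k−j)d}` points of `T^{(j)}`, and `(Lʲε)^κ·L^{(k−j)d} = (Lᵏε)^κ·L^{−(k−j)(κ−d)}` (`L, ε > 0`,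
`j ≤ k`, any real `κ`). [cite: Balaban1982Higgs2, p.578] -/
theorem scale_volume_578 {L ε : ℝ} (hL : 0 < L) (hε : 0 < ε) (κ : ℝ) (d : ℕ) {j k : ℕ} (hjk : j ≤ k) :
    (L ^ j * ε) ^ κ * (L ^ (k - j)) ^ d = (L ^ k * ε) ^ κ * L ^ (-(((k - j : ℕ) : ℝ) * (κ - d))) := by
  have hLj : 0 < L ^ j := pow_pos hL j
  have hLk : 0 < L ^ k := pow_pos hL k
  have hm : L ^ k = L ^ j * L ^ (k - j) := by rw [← pow_add, Nat.add_sub_cancel' hjk]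
  -- write everything with real exponents of the positive base `L`
  have h1 : (L ^ j * ε) ^ κ = (L ^ k * ε) ^ κ * (L ^ (k - j)) ^ (-κ) := by
    rw [hm, mul_assoc, mul_comm (L ^ (k - j)) ε, ← mul_assoc, Real.mul_rpow (by positivity) (pow_pos hL _).le,
      mul_assoc, ← Real.rpow_add (pow_pos hL _), add_neg_cancel, Real.rpow_zero, mul_one]
  rw [h1, mul_assoc]
  congr 1
  rw [← Real.rpow_natCast (L ^ (k - j)) d, ← Real.rpow_add (pow_pos hL _), ← Real.rpow_natCast L (k - j),
    ← Real.rpow_mul hL.le]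
  congr 1
  ring

/-- The p. 578 error with its volume factor, in the two printed forms: `C(Lʲε)^κ·(L^{(k−j)d}|Λ|) = C(Lᵏε)^κ|Λ|·L^{−(k−j)κ₀}`,
`κ₀ = κ − d`. [cite: Balaban1982Higgs2, p.578] -/
theorem error_578_eq {L ε : ℝ} (hL : 0 < L) (hε : 0 < ε) (κ : ℝ) (d : ℕ) {j k : ℕ} (hjk : j ≤ k) (C V : ℝ) :
    C * (L ^ j * ε) ^ κ * ((L ^ (k - j)) ^ d * V) = C * (L ^ k * ε) ^ κ * V * L ^ (-(((k - j : ℕ) : ℝ) * (κ - d))) := by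
  have h := scale_volume_578 hL hε κ d hjk
  calc C * (L ^ j * ε) ^ κ * ((L ^ (k - j)) ^ d * V) = C * V * ((L ^ j * ε) ^ κ * (L ^ (k - j)) ^ d) := by ring
    _ = C * V * ((L ^ k * ε) ^ κ * L ^ (-(((k - j : ℕ) : ℝ) * (κ - d)))) := by rw [h]
    _ = C * (L ^ k * ε) ^ κ * V * L ^ (-(((k - j : ℕ) : ℝ) * (κ - d))) := by ring

/-- The geometric sum over the scales: `Σ_{j<k} L^{−(k−j)κ₀} ≤ 1/(L^{κ₀} − 1)` for `L > 1`, `κ₀ > 0`, uniformly in `k`.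
[folklore] [cite: Balaban1982Higgs2, p.578–579] -/
theorem sum_rpow_neg_le {L κ₀ : ℝ} (hL : 1 < L) (hκ : 0 < κ₀) (k : ℕ) :
    ∑ j ∈ range k, L ^ (-(((k - j : ℕ) : ℝ) * κ₀)) ≤ 1 / (L ^ κ₀ - 1) := by
  have hL0 : 0 < L := zero_lt_one.trans hL
  set q : ℝ := L ^ (-κ₀) with hq
  have hq0 : 0 < q := Real.rpow_pos_of_pos hL0 _
  have hq1 : q < 1 := Real.rpow_lt_one_of_one_lt_of_neg hL (by linarith)
  have hLκ : 1 < L ^ κ₀ := Real.one_lt_rpow hL hκ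
  -- the summands are `q^(k-j)`, i.e. `q^1, …, q^k`
  have hterm : ∀ j ∈ range k, L ^ (-(((k - j : ℕ) : ℝ) * κ₀)) = q ^ (k - j) := by
    intro j hj
    rw [hq, ← Real.rpow_natCast (L ^ (-κ₀)) (k - j), ← Real.rpow_mul hL0.le]
    congr 1; ring
  have hrefl : ∑ j ∈ range k, q ^ (k - j) = ∑ m ∈ range k, q ^ (m + 1) := by
    rw [← Finset.sum_range_reflect (fun m => q ^ (m + 1)) k]
    refine Finset.sum_congr rfl fun j hj => ?_
    have hj' := Finset.mem_range.1 hj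
    congr 1
    omega
  have hgeom : ∑ m ∈ range k, q ^ (m + 1) ≤ q / (1 - q) := by
    have hs : ∑ m ∈ range k, q ^ m ≤ (1 - q)⁻¹ := by
      rw [geom_sum_eq hq1.ne k]
      have : (q ^ k - 1) / (q - 1) = (1 - q ^ k) * (1 - q)⁻¹ := by
        rw [div_eq_mul_inv, ← neg_sub 1 (q ^ k), ← neg_sub 1 q, inv_neg, neg_mul_neg]
      rw [this]
      exact mul_le_of_le_one_left (inv_nonneg.2 (by linarith)) (by linarith [pow_nonneg hq0.le k])
    calc ∑ m ∈ range k, q ^ (m + 1) = q * ∑ m ∈ range k, q ^ m := by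
          rw [Finset.mul_sum]; exact Finset.sum_congr rfl fun m _ => by ring
      _ ≤ q * (1 - q)⁻¹ := mul_le_mul_of_nonneg_left hs hq0.le
      _ = q / (1 - q) := (div_eq_mul_inv _ _).symm
  have hfin : q / (1 - q) = 1 / (L ^ κ₀ - 1) := by
    have hqL : q = (L ^ κ₀)⁻¹ := by rw [hq, Real.rpow_neg hL0.le]
    rw [hqL]
    have hne : L ^ κ₀ ≠ 0 := by positivity
    have hne1 : L ^ κ₀ - 1 ≠ 0 := by linarith
    field_simp
  rw [Finset.sum_congr rfl hterm, hrefl]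
  exact hgeom.trans hfin.le

/-- **«Gathering together all the expansions and the estimates of the factors Z^{(j)}»** (p. 579, before (2.107)), the
arithmetic: the p. 578 errors `C(Lʲε)^κ|B^{k−j}(Λ₂^{(k)})|`, `j = 0, …, k − 1`, sum to at most `C(Lᵏε)^κ|Λ₂^{(k)}|/(L^{κ₀} − 1)`
— again `O((Lᵏε)^κ)|Λ₂^{(k)}|`, with a constant INDEPENDENT of `k` (`L > 1`, `κ₀ = κ − d > 0`, `C, |Λ₂^{(k)}| ≥ 0`).
[cite: Balaban1982Higgs2, pp.578–579, (2.107)] -/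
theorem sum_scale_errors_le {L ε κ C V : ℝ} {d : ℕ} (hL : 1 < L) (hε : 0 < ε) (hκ : (d : ℝ) < κ) (hC : 0 ≤ C)
    (hV : 0 ≤ V) (k : ℕ) :
    ∑ j ∈ range k, C * (L ^ j * ε) ^ κ * ((L ^ (k - j)) ^ d * V)
      ≤ C * (L ^ k * ε) ^ κ * V / (L ^ (κ - d) - 1) := by
  have hL0 : 0 < L := zero_lt_one.trans hL
  have hrw : ∀ j ∈ range k, C * (L ^ j * ε) ^ κ * ((L ^ (k - j)) ^ d * V)
      = C * (L ^ k * ε) ^ κ * V * L ^ (-(((k - j : ℕ) : ℝ) * (κ - d))) := fun j hj =>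
    error_578_eq hL0 hε κ d (Finset.mem_range.1 hj).le C V
  rw [Finset.sum_congr rfl hrw, ← Finset.mul_sum]
  have hA : 0 ≤ C * (L ^ k * ε) ^ κ * V := by positivity
  calc C * (L ^ k * ε) ^ κ * V * ∑ j ∈ range k, L ^ (-(((k - j : ℕ) : ℝ) * (κ - d)))
      ≤ C * (L ^ k * ε) ^ κ * V * (1 / (L ^ (κ - d) - 1)) :=
        mul_le_mul_of_nonneg_left (sum_rpow_neg_le hL (by linarith) k) hA
    _ = C * (L ^ k * ε) ^ κ * V / (L ^ (κ - d) - 1) := by rw [mul_one_div]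

end Literature.MathematicalPhysics.QuantumFieldTheory.Balaban1983to89.B2Eq2106LogZSum
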